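import Summits.Ventures.YMGap.Thresholds.OneLinkFluctuations
import Summits.Ventures.YMGap.Thresholds.OneLinkEigenMoments
import HarnessLib

/-!
# Venture YMGap — the one-link modulus beyond first order, part 9: SECOND MOMENTS of the complex linear statistics under `ν_B`

HONEST FRAMING: venture file of the cell `pub-ymgap` (QuantumFields programme), strong-coupling LATTICE bookkeeping for `SU(N)`
lattice Yang–Mills; nothing about the continuum or the mass gap in the Clay sense.  No number of record («F4», part 3, of the cell
note `HOME/p2/ONE-LINK-HIERARCHY.md` §4).

WHAT.  `ν_B(dg) ∝ exp(N Re tr(gB)) dg`, `N ≥ 2`, `‖B‖_op < 1/2`, `ρ = N(1/2 − ‖B‖_op)`.  For every `M`: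
* `norm_mean_trace_le`: `√((E Re tr(gM))² + (E Im tr(gM))²) ≤ (N/(N−1/N))·2√N‖B‖_op‖M‖_F` — the tree's Schwinger–Dyson mean bound
  (`abs_mean_linear_le`) made rotation invariant (applied to `e^{−iθ}M`);
* `integral_normSq_trace_eq`: `∫ ‖tr(gM)‖² dν = Var Re + Var Im + (E Re)² + (E Im)²`;
* `sqrt_integral_normSq_trace_le`: `√(∫ ‖tr(gM)‖² dν) ≤ (N/(N−1/N))·2√N‖B‖_op‖M‖_F + ‖M‖_F/√ρ`.
With `M = Δ` (`‖Δ‖_F = 1`) and `M = B` (`‖B‖_F ≤ √N‖B‖_op`) these are the quantities `‖z₂‖₂`, `‖z₁‖₂` of the cell note (first-order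
`m₁`; the second-order `m₁` of (4.2) replaces the first summand later).

References: cell note §4; Shen–Zhu–Zhu CMP 400 (2023) §4.1.
-/

noncomputable section

open scoped Matrix ComplexConjugate BigOperators ContDiff Matrix.Norms.Frobenius
open Matrix Complex Finset MeasureTheory ProbabilityTheory
open Literature.MathematicalPhysics.QuantumFieldTheory
open Literature.MathematicalPhysics.QuantumFieldTheory.SUNBakryEmery

namespace Summit.Ventures.YMGap.OneLinkEigen

variable {N : ℕ}

/-- `√(a² + b²) ≤ K` from `∀ θ-rotations`: if `c₁ a + c₂ b ≤ K` for the unit vector `(c₁,c₂) = (a,b)/√(a²+b²)`, packaged as: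
`a·a + b·b ≤ K √(a² + b²)` and `0 ≤ K` imply `√(a²+b²) ≤ K`. [folklore] -/
theorem sqrt_sq_add_sq_le_of_mul {a b K : ℝ} (hK : 0 ≤ K) (h : a * a + b * b ≤ K * Real.sqrt (a ^ 2 + b ^ 2)) :
    Real.sqrt (a ^ 2 + b ^ 2) ≤ K := by
  set s := Real.sqrt (a ^ 2 + b ^ 2) with hs
  have hs0 : 0 ≤ s := Real.sqrt_nonneg _
  have hss : s * s = a ^ 2 + b ^ 2 := Real.mul_self_sqrt (by positivity)
  by_cases h0 : s = 0
  · rw [h0]; exact hK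
  · have hpos : 0 < s := lt_of_le_of_ne hs0 (Ne.symm h0)
    have : s * s ≤ K * s := by nlinarith
    exact le_of_mul_le_mul_right this hpos

/-- **Rotation-invariant Schwinger–Dyson mean bound**: `√((E Re tr(gM))² + (E Im tr(gM))²) ≤ (N/(N−1/N))·2√N‖B‖_op‖M‖_F`. [folklore] -/
theorem norm_mean_trace_le (hN : 2 ≤ N) (B M : Matrix (Fin N) (Fin N) ℂ) :
    Real.sqrt ((∫ g, ((g : Matrix (Fin N) (Fin N) ℂ) * M).trace.re
          ∂(haarProbability (SUN N)).tilted (fun g => (N : ℝ) * ((g : Matrix (Fin N) (Fin N) ℂ) * B).trace.re)) ^ 2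
        + (∫ g, ((g : Matrix (Fin N) (Fin N) ℂ) * M).trace.im
          ∂(haarProbability (SUN N)).tilted (fun g => (N : ℝ) * ((g : Matrix (Fin N) (Fin N) ℂ) * B).trace.re)) ^ 2) ≤
      (N : ℝ) / ((N : ℝ) - 1 / N) * (2 * Real.sqrt N * matrixOpNorm B * frobNorm M) := by
  have hN0 : N ≠ 0 := by omega
  have hNpos : (0 : ℝ) < N := Nat.cast_pos.2 (Nat.pos_of_ne_zero hN0)
  have hN2 : (2 : ℝ) ≤ N := by exact_mod_cast hN
  have hlampos : 0 < (N : ℝ) - 1 / N := by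
    have : (1 : ℝ) / N ≤ 1 / 2 := by rw [div_le_div_iff₀ hNpos (by norm_num)]; linarith
    linarith
  set ν : Measure (SUN N) :=
    (haarProbability (SUN N)).tilted (fun g => (N : ℝ) * ((g : Matrix (Fin N) (Fin N) ℂ) * B).trace.re) with hν
  have hexpi : Integrable (fun g : SUN N => Real.exp ((N : ℝ) * ((g : Matrix (Fin N) (Fin N) ℂ) * B).trace.re))
      (haarProbability (SUN N)) :=
    integrable_of_continuous_SUN (Real.continuous_exp.comp (continuous_restrict (contDiff_pot (N : ℝ) B))) _
  haveI : IsProbabilityMeasure ν := isProbabilityMeasure_tilted hexpi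
  set a : ℝ := ∫ g, ((g : Matrix (Fin N) (Fin N) ℂ) * M).trace.re ∂ν with ha
  set b : ℝ := ∫ g, ((g : Matrix (Fin N) (Fin N) ℂ) * M).trace.im ∂ν with hb
  set K : ℝ := (N : ℝ) / ((N : ℝ) - 1 / N) * (2 * Real.sqrt N * matrixOpNorm B * frobNorm M) with hK
  have hK0 : 0 ≤ K := by
    rw [hK]
    exact mul_nonneg (div_nonneg hNpos.le hlampos.le)
      (mul_nonneg (mul_nonneg (mul_nonneg (by norm_num) (Real.sqrt_nonneg _)) (matrixOpNorm_nonneg B)) (frobNorm_nonneg M))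
  refine sqrt_sq_add_sq_le_of_mul hK0 ?_
  -- the rotated matrix `c • M`, `c = a - i b`
  set c : ℂ := (a : ℂ) - (b : ℂ) * I with hc
  have hcn : ‖c‖ = Real.sqrt (a ^ 2 + b ^ 2) := by
    rw [hc, Complex.norm_def, Complex.normSq_apply]
    congr 1
    simp [sq]
  have hre : ∀ g : SUN N, ((g : Matrix (Fin N) (Fin N) ℂ) * (c • M)).trace.re =
      a * ((g : Matrix (Fin N) (Fin N) ℂ) * M).trace.re + b * ((g : Matrix (Fin N) (Fin N) ℂ) * M).trace.im := by
    intro g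
    rw [Matrix.mul_smul, trace_smul, smul_eq_mul, hc, mul_re, sub_re, sub_im, ofReal_re, ofReal_im, mul_re, mul_im,
      ofReal_re, ofReal_im, I_re, I_im]
    ring
  have h := abs_mean_linear_le hN B (c • M)
  rw [← hν] at h
  simp_rw [hre] at h
  have ire : Integrable (fun g : SUN N => ((g : Matrix (Fin N) (Fin N) ℂ) * M).trace.re) ν :=
    integrable_of_continuous_SUN (continuous_re_trace_su_mul M) ν
  have iim : Integrable (fun g : SUN N => ((g : Matrix (Fin N) (Fin N) ℂ) * M).trace.im) ν :=
    integrable_of_continuous_SUN (continuous_restrict (N := N) (contDiff_pot 1 ((-I) • M)) |>.congr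
      (fun g => by simp only [pot, one_mul, re_trace_mul_negI_smul])) ν
  rw [integral_add (ire.const_mul a) (iim.const_mul b), integral_const_mul, integral_const_mul, ← ha, ← hb,
    frobNorm_smul, hcn] at h
  calc a * a + b * b ≤ |a * a + b * b| := le_abs_self _
    _ ≤ (N : ℝ) / ((N : ℝ) - 1 / N) * (2 * Real.sqrt N * matrixOpNorm B * (Real.sqrt (a ^ 2 + b ^ 2) * frobNorm M)) := h
    _ = K * Real.sqrt (a ^ 2 + b ^ 2) := by rw [hK]; ring

/-- **Second moment of the complex linear statistic**:
`√(∫ ‖tr(gM)‖² dν_B) ≤ (N/(N−1/N))·2√N‖B‖_op‖M‖_F + ‖M‖_F/√(N(1/2 − ‖B‖_op))`. [folklore] -/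
theorem sqrt_integral_normSq_trace_le (hN : 2 ≤ N) {B : Matrix (Fin N) (Fin N) ℂ} (hB : matrixOpNorm B < 1 / 2)
    (M : Matrix (Fin N) (Fin N) ℂ) :
    Real.sqrt (∫ g, ‖((g : Matrix (Fin N) (Fin N) ℂ) * M).trace‖ ^ 2
        ∂(haarProbability (SUN N)).tilted (fun g => (N : ℝ) * ((g : Matrix (Fin N) (Fin N) ℂ) * B).trace.re)) ≤
      (N : ℝ) / ((N : ℝ) - 1 / N) * (2 * Real.sqrt N * matrixOpNorm B * frobNorm M)
        + frobNorm M / Real.sqrt ((N : ℝ) * (1 / 2 - matrixOpNorm B)) := by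
  have hN0 : N ≠ 0 := by omega
  have hNpos : (0 : ℝ) < N := Nat.cast_pos.2 (Nat.pos_of_ne_zero hN0)
  have hK : 0 < (N : ℝ) * (1 / 2 - matrixOpNorm B) := mul_pos hNpos (by linarith)
  set ν : Measure (SUN N) :=
    (haarProbability (SUN N)).tilted (fun g => (N : ℝ) * ((g : Matrix (Fin N) (Fin N) ℂ) * B).trace.re) with hν
  have hexpi : Integrable (fun g : SUN N => Real.exp ((N : ℝ) * ((g : Matrix (Fin N) (Fin N) ℂ) * B).trace.re))
      (haarProbability (SUN N)) :=
    integrable_of_continuous_SUN (Real.continuous_exp.comp (continuous_restrict (contDiff_pot (N : ℝ) B))) _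
  haveI : IsProbabilityMeasure ν := isProbabilityMeasure_tilted hexpi
  set fr : SUN N → ℝ := fun g => ((g : Matrix (Fin N) (Fin N) ℂ) * M).trace.re with hfr
  set fi : SUN N → ℝ := fun g => ((g : Matrix (Fin N) (Fin N) ℂ) * M).trace.im with hfi
  have hfrc : Continuous fr := continuous_re_trace_su_mul M
  have hfic : Continuous fi := (continuous_restrict (N := N) (contDiff_pot 1 ((-I) • M))).congr
    (fun g => by simp only [pot, one_mul, re_trace_mul_negI_smul, hfi])
  have mr : MemLp fr 2 ν := memLp_two_of_continuous hfrc ν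
  have mi : MemLp fi 2 ν := memLp_two_of_continuous hfic ν
  -- ∫ ‖z‖² = ∫ fr² + ∫ fi²
  have hsq : (fun g : SUN N => ‖((g : Matrix (Fin N) (Fin N) ℂ) * M).trace‖ ^ 2) = fun g => fr g ^ 2 + fi g ^ 2 := by
    funext g; rw [Complex.sq_norm, Complex.normSq_apply]; simp only [hfr, hfi]; ring
  have i1 : Integrable (fun g => fr g ^ 2) ν := integrable_of_continuous_SUN (hfrc.pow 2) ν
  have i2 : Integrable (fun g => fi g ^ 2) ν := integrable_of_continuous_SUN (hfic.pow 2) ν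
  have hvr : ∫ g, fr g ^ 2 ∂ν = Var[fr; ν] + (∫ g, fr g ∂ν) ^ 2 := by
    rw [variance_eq_sub mr]; simp
  have hvi : ∫ g, fi g ^ 2 ∂ν = Var[fi; ν] + (∫ g, fi g ∂ν) ^ 2 := by
    rw [variance_eq_sub mi]; simp
  have hvar := variance_re_add_variance_im_le hN0 hB M (N := N)
  rw [← hν] at hvar
  have hmean := norm_mean_trace_le hN B M
  rw [← hν] at hmean
  set A : ℝ := (N : ℝ) / ((N : ℝ) - 1 / N) * (2 * Real.sqrt N * matrixOpNorm B * frobNorm M) with hA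
  set V : ℝ := frobNorm M ^ 2 / ((N : ℝ) * (1 / 2 - matrixOpNorm B)) with hV
  have hA0 : 0 ≤ A := (Real.sqrt_nonneg _).trans hmean
  have hV0 : 0 ≤ V := by positivity
  have htot : ∫ g, ‖((g : Matrix (Fin N) (Fin N) ℂ) * M).trace‖ ^ 2 ∂ν ≤ (A + Real.sqrt V) ^ 2 := by
    rw [hsq, integral_add i1 i2, hvr, hvi]
    have hm2 : (∫ g, fr g ∂ν) ^ 2 + (∫ g, fi g ∂ν) ^ 2 ≤ A ^ 2 := by
      have h0 : 0 ≤ (∫ g, fr g ∂ν) ^ 2 + (∫ g, fi g ∂ν) ^ 2 := by positivity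
      calc (∫ g, fr g ∂ν) ^ 2 + (∫ g, fi g ∂ν) ^ 2 = Real.sqrt ((∫ g, fr g ∂ν) ^ 2 + (∫ g, fi g ∂ν) ^ 2) ^ 2 :=
            (Real.sq_sqrt h0).symm
        _ ≤ A ^ 2 := pow_le_pow_left₀ (Real.sqrt_nonneg _) hmean 2
    have hsV : Real.sqrt V ^ 2 = V := Real.sq_sqrt hV0
    nlinarith [hvar, hm2, hsV, mul_nonneg hA0 (Real.sqrt_nonneg V)]
  have hsqrtV : Real.sqrt V = frobNorm M / Real.sqrt ((N : ℝ) * (1 / 2 - matrixOpNorm B)) := by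
    rw [hV, Real.sqrt_div' _ hK.le, Real.sqrt_sq (frobNorm_nonneg M)]
  calc Real.sqrt (∫ g, ‖((g : Matrix (Fin N) (Fin N) ℂ) * M).trace‖ ^ 2 ∂ν) ≤ Real.sqrt ((A + Real.sqrt V) ^ 2) :=
        Real.sqrt_le_sqrt htot
    _ = A + Real.sqrt V := Real.sqrt_sq (add_nonneg hA0 (Real.sqrt_nonneg _))
    _ = _ := by rw [hsqrtV]

end Summit.Ventures.YMGap.OneLinkEigen
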